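import Summits.ValiantsHypothesis.ValiantsHypothesis.Theorems.KPlusLogSqLawTropicalBThresholdCodes
import Summits.ValiantsHypothesis.ValiantsHypothesis.Theorems.LacunarySymmetroidMatrixDescartesCensusTropicalKLawStatic
import Summits.ValiantsHypothesis.ValiantsHypothesis.Theorems.KPlusLogSqLawStaticTridiagonalSupport

/-!
# Route «KPlusLogSqLaw», crux `TropicalB` (stmt-ValiantsHypothesis-19771) — THRESHOLD NORMAL FORM: every static design is dominated,
# in vertex count, by a DENSE boundary-type design over any entry-separating boundary family (`3(⌊log₂ m⌋+1)` boundaries suffice)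

HONEST FRAMING.  Helper toward the registered stubs `stub_tropThin` / `stub_tropFat` of `Cruxes/TropicalB/Lines/birth.lean`
(crux `Summit.ValiantsHypothesis.ValiantsHypothesis.Theses.KPlusLogSqLaw.TropicalB`, item `stmt-ValiantsHypothesis-19771`, route
`KPlusLogSqLaw`; cell `pub-symmetroid`, seat val-sym-trop-p1 g15, 2026-08-28; `--supports … --as helper`).  A NORMAL FORM for the
boundary-type (permutation-register) sector of `…TropicalBBoundarySectorDefs` (p447010, val-sym-trop-p1 g2).  Everything here is a
comparison of two designs; nothing bounds `TropicalB` in its window, nothing bears on `WeakLifting`, DoorA26 / DoorA34, `MatrixDescartes`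
(stmt-ValiantsHypothesis-18050) or VP ≠ VNP.  No definition is introduced.  The corollaries (the `B`-uniform linear-exponent boundary
vertex law ⇒ a `K`-free quasi-polynomial cap for all static designs ⇒ `TropicalB`) are in the companion file `…TropicalBThresholdUniform`.

§1 WINDOW LEMMA (`isDominant_window`, any design): a term dominant at some integer slope is dominant at a slope `θ` with
`|θ| ≤ 2·Σ|v| + 1` (beyond the window the slope order alone decides every comparison).
§2 THRESHOLD EMBEDDING (`card_dominant_le_of_code`): let `π ρ : Fin B → Equiv.Perm (Fin m)` be ANY boundary family whose pattern map
`(a, b) ↦ pattern π ρ a b` is injective (an entry-separating CODE; `…TropicalBThresholdCodes.exists_injective_code` gives one with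
`B = 3L` at `m = 2^L`).  For a STATIC design `(d, v, ε)` of format `(m, K)` (at most one present class per entry) let `Y` be the DENSE
boundary-type design of format `(m, K+1)` over `(π, ρ)`: entry `(a, b)` carries exactly the class `lab (pattern a b)` = its old class
(shifted by `Fin.castSucc`) if it was present, the junk class `Fin.last K` (exponent `0`, valuation `N = 2W·m·Σd + 2Σ|v| + 1`, `W` the
window) otherwise; old valuations kept (`exists_lab`, `exists_val`, `exists_exp`).  Then `p ↦ (σ_p, forced classes)` maps the dominant
terms of the old design injectively into dominant terms of `Y` (inside the window a competitor using a junk entry loses by `N`; a junk-free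
competitor is an old competitor), so `#Dom(d, v, ε) ≤ #Dom(Y)`.  READING: «`O(log m)` ORDER BITS ARE UNIVERSAL» — the support and class
structure of every static design is order structure of `3(⌊log₂ m⌋+1)` pairs of permutations (and `≥ 2⌊log₂ m⌋` are needed by counting,
`sq_le_two_pow_of_injective`); the boundary programme is therefore a genuine SECTOR only at FIXED `B` (the open `BoundaryVertexLaw 2 2`).
[this cell; folklore ingredients: big-`M` penalties, bit codes]
-/

set_option linter.dupNamespace false
set_option autoImplicit false

namespace Summit.ValiantsHypothesis.ValiantsHypothesis.Theorems.KPlusLogSqLaw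

namespace BoundarySector

open Summit.ValiantsHypothesis.ValiantsHypothesis.Theorems.MatrixDescartes.Negative
open Summit.ValiantsHypothesis.ValiantsHypothesis.Theorems.LacunarySymmetroidMatrixDescartes
open Summit.ValiantsHypothesis.ValiantsHypothesis.Theorems.LacunarySymmetroidMatrixDescartes.TropicalCensus
open Summit.ValiantsHypothesis.ValiantsHypothesis.Theses.KPlusLogSqLaw (TropicalB)
open scoped BigOperators
open Finset

/-! ## 1. Valuation bounds and the window lemma (any design) -/

section Window

variable {m K : ℕ}

/-- one valuation is below its column total. [folklore] -/
theorem abs_le_col (v : Fin m → Fin m → Fin K → ℤ) (a b : Fin m) (l : Fin K) : |v a b l| ≤ ∑ a', ∑ l', |v a' b l'| :=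
  calc |v a b l| ≤ ∑ l', |v a b l'| :=
        single_le_sum (f := fun l' => |v a b l'|) (fun _ _ => abs_nonneg _) (mem_univ l)
    _ ≤ ∑ a', ∑ l', |v a' b l'| :=
        single_le_sum (f := fun a' => ∑ l', |v a' b l'|) (fun _ _ => sum_nonneg fun _ _ => abs_nonneg _) (mem_univ a)

/-- column totals are non-negative. [folklore] -/
theorem col_nonneg (v : Fin m → Fin m → Fin K → ℤ) (b : Fin m) : 0 ≤ ∑ a', ∑ l', |v a' b l'| :=
  sum_nonneg fun _ _ => sum_nonneg fun _ _ => abs_nonneg _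

/-- the total of absolute valuations is non-negative. [folklore] -/
theorem total_nonneg (v : Fin m → Fin m → Fin K → ℤ) : 0 ≤ ∑ b, ∑ a, ∑ l, |v a b l| :=
  sum_nonneg fun b _ => col_nonneg v b

/-- the valuation sum of any term is bounded by the total of absolute valuations. [folklore] -/
theorem abs_val_le_total (v : Fin m → Fin m → Fin K → ℤ) (p : Equiv.Perm (Fin m) × (Fin m → Fin K)) :
    |∑ i, v (p.1 i) i (p.2 i)| ≤ ∑ b, ∑ a, ∑ l, |v a b l| :=
  calc |∑ i, v (p.1 i) i (p.2 i)| ≤ ∑ i, |v (p.1 i) i (p.2 i)| := abs_sum_le_sum_abs _ _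
    _ ≤ ∑ i, ∑ a, ∑ l, |v a i l| := sum_le_sum fun i _ => abs_le_col v (p.1 i) i (p.2 i)

/-- **WINDOW LEMMA.**  A term dominant at some integer slope is dominant at a slope of absolute value `≤ 2·Σ|v| + 1`: beyond the window
no competitor of larger (resp. smaller) slope survives, and the others compare by the same inequality. [folklore] -/
theorem isDominant_window (d : Fin K → ℕ) (v ε : Fin m → Fin m → Fin K → ℤ) {θ : ℤ}
    {p : Equiv.Perm (Fin m) × (Fin m → Fin K)} (hp : IsDominant d v ε θ p) :
    ∃ θ' : ℤ, |θ'| ≤ 2 * (∑ b, ∑ a, ∑ l, |v a b l|) + 1 ∧ IsDominant d v ε θ' p := by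
  set T : ℤ := ∑ b, ∑ a, ∑ l, |v a b l| with hT
  have hT0 : 0 ≤ T := total_nonneg v
  by_cases hθ : |θ| ≤ 2 * T + 1
  · exact ⟨θ, hθ, hp⟩
  have hVp := abs_val_le_total v p
  rw [abs_le] at hVp
  rcases le_or_gt 0 θ with hθ0 | hθ0
  · -- `θ > 2T + 1`: dominant at `2T + 1`
    have hθW : 2 * T + 1 < θ := by rw [abs_of_nonneg hθ0] at hθ; omega
    refine ⟨2 * T + 1, by rw [abs_of_nonneg (by omega)], hp.1, fun q hq hqp => ?_⟩
    have h := hp.2 q hq hqp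
    have hVq := abs_val_le_total v q
    rw [abs_le] at hVq
    unfold tropWeight at h ⊢
    rcases lt_trichotomy (∑ i, (d (q.2 i) : ℤ)) (∑ i, (d (p.2 i) : ℤ)) with hS | hS | hS
    · nlinarith
    · rw [hS] at h ⊢; linarith
    · nlinarith
  · -- `θ < -(2T + 1)`: dominant at `-(2T + 1)`
    have hθW : θ < -(2 * T + 1) := by rw [abs_of_neg hθ0] at hθ; omega
    refine ⟨-(2 * T + 1), by rw [abs_neg, abs_of_nonneg (by omega)], hp.1, fun q hq hqp => ?_⟩
    have h := hp.2 q hq hqp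
    have hVq := abs_val_le_total v q
    rw [abs_le] at hVq
    unfold tropWeight at h ⊢
    rcases lt_trichotomy (∑ i, (d (q.2 i) : ℤ)) (∑ i, (d (p.2 i) : ℤ)) with hS | hS | hS
    · nlinarith
    · rw [hS] at h ⊢; linarith
    · nlinarith

end Window

/-! ## 2. The threshold embedding of a static design -/

section Embedding

variable {m K B : ℕ}

/-- the labelling of an entry-separating code: a function `lab` on patterns reading off the (shifted) class of a present entry and the junk
class `Fin.last K` at an absent one. [this cell] -/
theorem exists_lab (π ρ : Fin B → Equiv.Perm (Fin m))
    (hcode : Function.Injective fun ab : Fin m × Fin m => pattern π ρ ab.1 ab.2)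
    (ε : Fin m → Fin m → Fin K → ℤ) (hstat : IsStatic ε) :
    ∃ lab : (Fin B → Bool) → Fin (K + 1),
      (∀ a b l, ε a b l ≠ 0 → lab (pattern π ρ a b) = Fin.castSucc l) ∧
      (∀ a b, (∀ l, ε a b l = 0) → lab (pattern π ρ a b) = Fin.last K) := by
  classical
  refine ⟨fun f => if h : ∃ w : Fin m × Fin m × Fin K, pattern π ρ w.1 w.2.1 = f ∧ ε w.1 w.2.1 w.2.2 ≠ 0
      then Fin.castSucc (Classical.choose h).2.2 else Fin.last K, ?_, ?_⟩
  · intro a b l hl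
    have hex : ∃ w : Fin m × Fin m × Fin K, pattern π ρ w.1 w.2.1 = pattern π ρ a b ∧ ε w.1 w.2.1 w.2.2 ≠ 0 :=
      ⟨(a, b, l), rfl, hl⟩
    simp only [dif_pos hex]
    congr 1
    obtain ⟨hw1, hw2⟩ := Classical.choose_spec hex
    set w := Classical.choose hex
    have hab : (w.1, w.2.1) = (a, b) := hcode hw1
    have ha : w.1 = a := congrArg Prod.fst hab
    have hb : w.2.1 = b := congrArg Prod.snd hab
    rw [ha, hb] at hw2
    exact hstat a b _ _ hw2 hl
  · intro a b habs
    have hnex : ¬ ∃ w : Fin m × Fin m × Fin K, pattern π ρ w.1 w.2.1 = pattern π ρ a b ∧ ε w.1 w.2.1 w.2.2 ≠ 0 := by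
      rintro ⟨w, hw1, hw2⟩
      have hab : (w.1, w.2.1) = (a, b) := hcode hw1
      have ha : w.1 = a := congrArg Prod.fst hab
      have hb : w.2.1 = b := congrArg Prod.snd hab
      rw [ha, hb] at hw2
      exact hw2 (habs _)
    simp only [dif_neg hnex]

/-- the new valuation: the old one at a present entry (class argument ignored), the penalty `N` at an absent one. [this cell] -/
theorem exists_val (ε : Fin m → Fin m → Fin K → ℤ) (hstat : IsStatic ε) (v : Fin m → Fin m → Fin K → ℤ) (N : ℤ) (K' : ℕ) :
    ∃ v' : Fin m → Fin m → Fin K' → ℤ,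
      (∀ a b l l', ε a b l ≠ 0 → v' a b l' = v a b l) ∧ (∀ a b l', (∀ l, ε a b l = 0) → v' a b l' = N) := by
  classical
  refine ⟨fun a b _ => if h : ∃ l, ε a b l ≠ 0 then v a b (Classical.choose h) else N, ?_, ?_⟩
  · intro a b l l' hl
    have hex : ∃ l, ε a b l ≠ 0 := ⟨l, hl⟩
    simp only [dif_pos hex]
    rw [hstat a b _ _ (Classical.choose_spec hex) hl]
  · intro a b l' habs
    have hnex : ¬ ∃ l, ε a b l ≠ 0 := fun ⟨l, hl⟩ => hl (habs l)
    simp only [dif_neg hnex]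

/-- the new exponents: old ones on `Fin.castSucc`, `0` on the junk class; all `≤ Σ d`. [this cell] -/
theorem exists_exp (d : Fin K → ℕ) :
    ∃ d' : Fin (K + 1) → ℕ, (∀ l, d' (Fin.castSucc l) = d l) ∧ d' (Fin.last K) = 0 ∧ ∀ l, d' l ≤ ∑ l', d l' := by
  refine ⟨fun l => if h : (l : ℕ) < K then d ⟨l, h⟩ else 0, ?_, ?_, ?_⟩
  · intro l; simp
  · simp
  · intro l
    by_cases h : (l : ℕ) < K
    · simp only [h, dif_pos]
      exact single_le_sum (f := d) (fun _ _ => Nat.zero_le _) (mem_univ _)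
    · simp [h]

open scoped Classical in
/-- **THRESHOLD EMBEDDING (vertex count).**  For an entry-separating boundary family `(π, ρ)` and a STATIC design `(d, v, ε)` of format
`(m, K)` there is a DENSE boundary-type design `(d', v', ε')` of format `(m, K+1)` over `(π, ρ)` with at least as many dominant terms.
[this cell] -/
theorem card_dominant_le_of_code (π ρ : Fin B → Equiv.Perm (Fin m))
    (hcode : Function.Injective fun ab : Fin m × Fin m => pattern π ρ ab.1 ab.2)
    (d : Fin K → ℕ) (v ε : Fin m → Fin m → Fin K → ℤ) (hstat : IsStatic ε) :
    ∃ (lab : (Fin B → Bool) → Fin (K + 1)) (d' : Fin (K + 1) → ℕ) (v' ε' : Fin m → Fin m → Fin (K + 1) → ℤ),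
      IsBoundaryDesign π ρ lab ε' ∧ (∀ a b l, (ε' a b l).natAbs ≤ 1) ∧
      (univ.filter fun q : Equiv.Perm (Fin m) × (Fin m → Fin K) => ∃ t : ℤ, IsDominant d v ε t q).card ≤
        (univ.filter fun q : Equiv.Perm (Fin m) × (Fin m → Fin (K + 1)) => ∃ t : ℤ, IsDominant d' v' ε' t q).card := by
  -- constants
  set T : ℤ := ∑ b, ∑ a, ∑ l, |v a b l| with hT
  set W : ℤ := 2 * T + 1 with hW
  set Sb : ℤ := (m : ℤ) * ∑ l, (d l : ℤ) with hSb
  set N : ℤ := 2 * W * Sb + 2 * T + 1 with hN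
  have hT0 : 0 ≤ T := total_nonneg v
  have hSb0 : 0 ≤ Sb := by positivity
  -- the new design
  obtain ⟨lab, hlab1, hlab0⟩ := exists_lab π ρ hcode ε hstat
  obtain ⟨v', hv'1, hv'0⟩ := exists_val ε hstat v N (K + 1)
  obtain ⟨d', hd'1, hd'0, hd'le⟩ := exists_exp d
  let ε' : Fin m → Fin m → Fin (K + 1) → ℤ := fun a b l => if l = lab (pattern π ρ a b) then 1 else 0
  have hbd : IsBoundaryDesign π ρ lab ε' := by
    intro a b l
    simp only [ε', ne_eq, ite_eq_right_iff, one_ne_zero, imp_false, not_not]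
  refine ⟨lab, d', v', ε', hbd, fun a b l => by simp only [ε']; split_ifs <;> simp, ?_⟩
  -- the map on terms
  let φ : Equiv.Perm (Fin m) × (Fin m → Fin K) → Equiv.Perm (Fin m) × (Fin m → Fin (K + 1)) :=
    fun p => (p.1, fun i => lab (pattern π ρ (p.1 i) i))
  -- forced classes: a present term of the new design is `φ` of its permutation
  have hforced : ∀ q : Equiv.Perm (Fin m) × (Fin m → Fin (K + 1)), termSign ε' q ≠ 0 →
      ∀ i, q.2 i = lab (pattern π ρ (q.1 i) i) := by
    intro q hq i
    have h := (termSign_ne_zero_iff ε' q).1 hq i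
    by_contra hne
    exact h (by simp only [ε', if_neg hne])
  have hφ_present : ∀ p : Equiv.Perm (Fin m) × (Fin m → Fin K), termSign ε' (φ p) ≠ 0 := by
    intro p
    rw [termSign_ne_zero_iff]
    intro i
    simp only [φ, ε', if_pos rfl]
    exact one_ne_zero
  -- on an old present term, `φ` shifts the classes, keeps slope and valuation
  have hφ_class : ∀ p : Equiv.Perm (Fin m) × (Fin m → Fin K), termSign ε p ≠ 0 →
      ∀ i, (φ p).2 i = Fin.castSucc (p.2 i) := by
    intro p hp i
    exact hlab1 _ _ _ ((termSign_ne_zero_iff ε p).1 hp i)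
  have hφ_weight : ∀ p : Equiv.Perm (Fin m) × (Fin m → Fin K), termSign ε p ≠ 0 → ∀ θ : ℤ,
      tropWeight d' v' θ (φ p) = tropWeight d v θ p := by
    intro p hp θ
    have hpres := (termSign_ne_zero_iff ε p).1 hp
    unfold tropWeight
    have e1 : ∑ i, (d' ((φ p).2 i) : ℤ) = ∑ i, (d (p.2 i) : ℤ) :=
      sum_congr rfl fun i _ => by rw [hφ_class p hp i, hd'1]
    have e2 : ∑ i, v' ((φ p).1 i) i ((φ p).2 i) = ∑ i, v (p.1 i) i (p.2 i) :=
      sum_congr rfl fun i _ => hv'1 _ _ _ _ (hpres i)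
    rw [e1, e2]
  -- slope bounds in the new design
  have hslope' : ∀ q : Equiv.Perm (Fin m) × (Fin m → Fin (K + 1)),
      0 ≤ ∑ i, (d' (q.2 i) : ℤ) ∧ ∑ i, (d' (q.2 i) : ℤ) ≤ Sb := by
    intro q
    refine ⟨sum_nonneg fun _ _ => by positivity, ?_⟩
    calc ∑ i, (d' (q.2 i) : ℤ) ≤ ∑ _i : Fin m, ∑ l, (d l : ℤ) := by
          refine sum_le_sum fun i _ => ?_
          exact_mod_cast hd'le (q.2 i)
      _ = Sb := by rw [sum_const, card_univ, Fintype.card_fin, nsmul_eq_mul]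
  -- valuation lower bound for a term using a junk entry
  have hjunk : ∀ (q : Equiv.Perm (Fin m) × (Fin m → Fin (K + 1))) (i₀ : Fin m), (∀ l, ε (q.1 i₀) i₀ l = 0) →
      N - T ≤ ∑ i, v' (q.1 i) i (q.2 i) := by
    intro q i₀ hi₀
    have hlow : ∀ i, -(∑ a, ∑ l, |v a i l|) ≤ v' (q.1 i) i (q.2 i) := by
      intro i
      by_cases h : ∃ l, ε (q.1 i) i l ≠ 0
      · obtain ⟨l, hl⟩ := h
        rw [hv'1 _ _ _ _ hl]
        have := abs_le_col v (q.1 i) i l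
        rw [abs_le] at this
        exact this.1
      · push Not at h
        rw [hv'0 _ _ _ h]
        have := col_nonneg v i
        nlinarith
    have hi₀v : v' (q.1 i₀) i₀ (q.2 i₀) = N := hv'0 _ _ _ hi₀
    rw [← add_sum_erase _ _ (mem_univ i₀), hi₀v]
    have hrest : -(∑ i ∈ univ.erase i₀, ∑ a, ∑ l, |v a i l|) ≤ ∑ i ∈ univ.erase i₀, v' (q.1 i) i (q.2 i) := by
      rw [← sum_neg_distrib]
      exact sum_le_sum fun i _ => hlow i
    have herase : ∑ i ∈ univ.erase i₀, ∑ a, ∑ l, |v a i l| ≤ T := by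
      rw [hT]
      exact sum_le_sum_of_subset_of_nonneg (erase_subset _ _) fun i _ _ => col_nonneg v i
    linarith
  -- `φ` maps dominant terms to dominant terms
  have hmap : ∀ p : Equiv.Perm (Fin m) × (Fin m → Fin K), (∃ t : ℤ, IsDominant d v ε t p) →
      ∃ t : ℤ, IsDominant d' v' ε' t (φ p) := by
    rintro p ⟨t, ht⟩
    obtain ⟨θ, hθW, hdom⟩ := isDominant_window d v ε ht
    have hp : termSign ε p ≠ 0 := hdom.1
    refine ⟨θ, hφ_present p, fun q' hne hq' => ?_⟩
    have hcl := hforced q' hq'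
    by_cases hall : ∀ i, ∃ l, ε (q'.1 i) i l ≠ 0
    · -- a junk-free competitor is an old competitor
      choose lam hlam using hall
      have hq : termSign ε (q'.1, lam) ≠ 0 := (termSign_ne_zero_iff ε (q'.1, lam)).2 hlam
      have hq'eq : q' = φ (q'.1, lam) := by
        refine Prod.ext rfl (funext fun i => ?_)
        exact hcl i
      have hqp : (q'.1, lam) ≠ p := by
        intro h
        apply hne
        rw [hq'eq, h]
      rw [hq'eq, hφ_weight _ hq, hφ_weight _ hp]
      exact hdom.2 _ hqp hq
    · -- a competitor using a junk entry loses by the penalty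
      push Not at hall
      obtain ⟨i₀, hi₀⟩ := hall
      have hV' := hjunk q' i₀ hi₀
      have hS' := hslope' q'
      have hSp := StaticTridiagonal.slope_le d p
      have hVp := abs_val_le_total v p
      rw [abs_le] at hVp
      rw [abs_le] at hθW
      rw [hφ_weight _ hp]
      unfold tropWeight
      have hSpb : ∑ i, (d (p.2 i) : ℤ) ≤ Sb := hSp.2
      nlinarith [hS'.1, hS'.2, hSp.1, hSpb, hVp.1, hVp.2, hθW.1, hθW.2, hV', hT0, hSb0]
  -- `φ` is injective on present old terms (staticity)
  have hinj : Set.InjOn φ ↑(univ.filter fun q : Equiv.Perm (Fin m) × (Fin m → Fin K) => ∃ t : ℤ, IsDominant d v ε t q) := by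
    intro p hp p' hp' h
    rw [coe_filter] at hp hp'
    obtain ⟨t, ht⟩ := hp.2
    obtain ⟨t', ht'⟩ := hp'.2
    have h1 : p.1 = p'.1 := by
      have e := congrArg Prod.fst h
      exact e
    refine Prod.ext h1 (funext fun i => ?_)
    have e := congrFun (congrArg Prod.snd h) i
    rw [hφ_class p ht.1 i, hφ_class p' ht'.1 i] at e
    exact Fin.castSucc_injective _ e
  refine card_le_card_of_injOn φ (fun p hp => ?_) hinj
  rw [mem_coe, mem_filter] at hp ⊢
  exact ⟨mem_univ _, hmap p hp.2⟩

end Embedding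

end BoundarySector

end Summit.ValiantsHypothesis.ValiantsHypothesis.Theorems.KPlusLogSqLaw
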